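import Summits.Ventures.PercRepro2.CaseOneGlue
import Summits.Ventures.PercRepro2.CaseOneRootsOnlyQ

/-!
# The glued classes and the Bernstein face lemma
(blind cell PercRepro2, p1 g17; S5 §2.3 «REVISED AT v19» — the face induction of the cell method)

With `CaseOneGlue.lean` (a root moves along an edge of weight `1`): the Props `ZSplitII` / `ZSplitI` /
`ZSplitIIQ` / `ZSplitIQ` are unchanged when a root is replaced by the other end of an edge of weight
`1` (`zSplitII_glue₂ : ZSplitII (…a₂…) ↔ ZSplitII (…w…)`, …); THE GLUED CLASSES: if the edges at `a₃`
go to `a₁` and to `w` only and `w` is glued to the root `a₂` by an edge of weight `1`, then `(ii)`,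
`(i)` and `(J1₁)` hold (`zSplitII_of_rootsOnly_glued₂`, `zSplitI_of_rootsOnly_glued₂`,
`jOneOne_of_rootsOnly_glued₂` — the face `e(w–a₂) = 3` of the sister shapes `uwa1` / `uwo` of
S5 (S5.a″) (l)), and `(ii-Q)`, `(i-Q)` too (`zSplitIIQ_of_rootsOnly_glued₂`, `zSplitIQ_of_rootsOnly_glued₂`,
from `CaseOneRootsOnlyQ`); likewise for the root `a₁` and for the classes «roots and `o`» / «roots and `b`»
(`zSplitII_of_rootsAndO_glued₂`, `zSplitII_of_rootsAndB_glued₂`, …); and THE BERNSTEIN FACE LEMMA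
(`nonneg_of_bern3_top_face`, `nonneg_of_bern3_faces`): a cubic in an edge weight `t ∈ [0, 1]` with
Bernstein coefficients `B₀, B₁, B₂, B₃` is nonnegative as soon as the interior coefficients are and
the face values `f 1` (`= B₃`, the edge glued) / `f 0` (`= B₀`, the edge deleted) are — which is how
a gadget certificate that fails only on a modified-base face composes with the class theorem of that
face. Own code; standard axioms. -/

namespace Summit.Ventures.PercRepro2

namespace CaseOne

section GlueProps
variable {V : Type*} {E : Type*} [Fintype E] [DecidableEq E] {R : Type*} [CommRing R]
  [LinearOrder R]
variable {ends : E → Sym2 V} {e : E} {p : E → R}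

/-- `(ii)` is unchanged when the root `a₂` moves to `w` along an edge of weight `1`. -/
theorem zSplitII_glue₂ (he : p e = 1) {a₂ w : V} (hends : ends e = s(a₂, w)) (o a₁ a₃ b : V) :
    ZSplitII p ends o a₁ a₂ a₃ b ↔ ZSplitII p ends o a₁ w a₃ b := by
  unfold ZSplitII; rw [iiExpr_glue₂ he hends]

/-- `(ii)` is unchanged when the root `a₁` moves to `w` along an edge of weight `1`. -/
theorem zSplitII_glue₁ (he : p e = 1) {a₁ w : V} (hends : ends e = s(a₁, w)) (o a₂ a₃ b : V) :
    ZSplitII p ends o a₁ a₂ a₃ b ↔ ZSplitII p ends o w a₂ a₃ b := by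
  unfold ZSplitII; rw [iiExpr_glue₁ he hends]

/-- `(i)` is unchanged when the root `a₂` moves to `w` along an edge of weight `1`. -/
theorem zSplitI_glue₂ (he : p e = 1) {a₂ w : V} (hends : ends e = s(a₂, w)) (o a₁ a₃ b : V) :
    ZSplitI p ends o a₁ a₂ a₃ b ↔ ZSplitI p ends o a₁ w a₃ b := by
  unfold ZSplitI; rw [iExpr_glue₂ he hends]

/-- `(i)` is unchanged when the root `a₁` moves to `w` along an edge of weight `1`. -/
theorem zSplitI_glue₁ (he : p e = 1) {a₁ w : V} (hends : ends e = s(a₁, w)) (o a₂ a₃ b : V) :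
    ZSplitI p ends o a₁ a₂ a₃ b ↔ ZSplitI p ends o w a₂ a₃ b := by
  unfold ZSplitI; rw [iExpr_glue₁ he hends]

/-- `(ii-Q)` is unchanged when the root `a₂` moves to `w` along an edge of weight `1`. -/
theorem zSplitIIQ_glue₂ (he : p e = 1) {a₂ w : V} (hends : ends e = s(a₂, w)) (o a₁ a₃ b : V) :
    ZSplitIIQ p ends o a₁ a₂ a₃ b ↔ ZSplitIIQ p ends o a₁ w a₃ b := by
  unfold ZSplitIIQ
  rw [Dqo_glue₂ he hends, probQ_glue₂ he hends, iiExprT_glue₂ he hends]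

/-- `(ii-Q)` is unchanged when the root `a₁` moves to `w` along an edge of weight `1`. -/
theorem zSplitIIQ_glue₁ (he : p e = 1) {a₁ w : V} (hends : ends e = s(a₁, w)) (o a₂ a₃ b : V) :
    ZSplitIIQ p ends o a₁ a₂ a₃ b ↔ ZSplitIIQ p ends o w a₂ a₃ b := by
  unfold ZSplitIIQ
  rw [Dqo_glue₁ he hends, probQ_glue₁ he hends, iiExprT_glue₁ he hends]

/-- `(i-Q)` is unchanged when the root `a₂` moves to `w` along an edge of weight `1`. -/
theorem zSplitIQ_glue₂ (he : p e = 1) {a₂ w : V} (hends : ends e = s(a₂, w)) (o a₁ a₃ b : V) :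
    ZSplitIQ p ends o a₁ a₂ a₃ b ↔ ZSplitIQ p ends o a₁ w a₃ b := by
  unfold ZSplitIQ
  rw [Dqo_glue₂ he hends, probQ_glue₂ he hends, iExprT_glue₂ he hends]

/-- `(i-Q)` is unchanged when the root `a₁` moves to `w` along an edge of weight `1`. -/
theorem zSplitIQ_glue₁ (he : p e = 1) {a₁ w : V} (hends : ends e = s(a₁, w)) (o a₂ a₃ b : V) :
    ZSplitIQ p ends o a₁ a₂ a₃ b ↔ ZSplitIQ p ends o w a₂ a₃ b := by
  unfold ZSplitIQ
  rw [Dqo_glue₁ he hends, probQ_glue₁ he hends, iExprT_glue₁ he hends]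

end GlueProps

/-! ## The glued classes: the index-`3` faces of the gadget shapes -/

section Glued
variable {V : Type*} {E : Type*} [Fintype E] [DecidableEq E] [Fintype V] [DecidableEq V]
  {R : Type*} [Field R] [LinearOrder R] [IsStrictOrderedRing R]
variable {ends : E → Sym2 V} {a₁ a₂ a₃ w : V} {e : E}

/-- **`(ii)` when every edge at `a₃` goes to `a₁` or to `w`, and `w` is glued to the root `a₂`** by an
edge of weight `1` (the face `e(w–a₂) = 3` of a gadget whose statement vertex `a₃` sees `a₁` and `w`). -/
theorem zSplitII_of_rootsOnly_glued₂ (p : E → R) (hp : IsProbVec p) (he : p e = 1)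
    (hends : ends e = s(a₂, w))
    (hroot : ∀ e', a₃ ∈ ends e' → ends e' = s(a₁, a₃) ∨ ends e' = s(w, a₃)) (h1 : a₁ ≠ a₃)
    (o b : V) : ZSplitII p ends o a₁ a₂ a₃ b :=
  (zSplitII_glue₂ he hends o a₁ a₃ b).2 (zSplitII_of_rootsOnly p hp hroot h1 o b)

/-- **`(ii)` when every edge at `a₃` goes to `w` or to `a₂`, and `w` is glued to the root `a₁`.** -/
theorem zSplitII_of_rootsOnly_glued₁ (p : E → R) (hp : IsProbVec p) (he : p e = 1)
    (hends : ends e = s(a₁, w))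
    (hroot : ∀ e', a₃ ∈ ends e' → ends e' = s(w, a₃) ∨ ends e' = s(a₂, a₃)) (hw : w ≠ a₃)
    (o b : V) : ZSplitII p ends o a₁ a₂ a₃ b :=
  (zSplitII_glue₁ he hends o a₂ a₃ b).2 (zSplitII_of_rootsOnly p hp hroot hw o b)

/-- **`(i)` when every edge at `a₃` goes to `a₁` or to `w`, and `w` is glued to the root `a₂`.** -/
theorem zSplitI_of_rootsOnly_glued₂ (p : E → R) (hp : IsProbVec p) (he : p e = 1)
    (hends : ends e = s(a₂, w))
    (hroot : ∀ e', a₃ ∈ ends e' → ends e' = s(a₁, a₃) ∨ ends e' = s(w, a₃)) (h1 : a₁ ≠ a₃)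
    (o : V) {b : V} (hb : b ≠ a₃) : ZSplitI p ends o a₁ a₂ a₃ b :=
  (zSplitI_glue₂ he hends o a₁ a₃ b).2 (zSplitI_of_rootsOnly p hp hroot h1 o hb)

/-- **`(i)` when every edge at `a₃` goes to `w` or to `a₂`, and `w` is glued to the root `a₁`.** -/
theorem zSplitI_of_rootsOnly_glued₁ (p : E → R) (hp : IsProbVec p) (he : p e = 1)
    (hends : ends e = s(a₁, w))
    (hroot : ∀ e', a₃ ∈ ends e' → ends e' = s(w, a₃) ∨ ends e' = s(a₂, a₃)) (hw : w ≠ a₃)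
    (o : V) {b : V} (hb : b ≠ a₃) : ZSplitI p ends o a₁ a₂ a₃ b :=
  (zSplitI_glue₁ he hends o a₂ a₃ b).2 (zSplitI_of_rootsOnly p hp hroot hw o hb)

/-- **`(J1₁)` for the glued root-only class** (`w` glued to `a₂`). -/
theorem jOneOne_of_rootsOnly_glued₂ (p : E → R) (hp : IsProbVec p) (he : p e = 1)
    (hends : ends e = s(a₂, w))
    (hroot : ∀ e', a₃ ∈ ends e' → ends e' = s(a₁, a₃) ∨ ends e' = s(w, a₃)) (h1 : a₁ ≠ a₃)
    (o : V) {b : V} (hb : b ≠ a₃) : JOneOne p ends o a₁ a₂ a₃ b :=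
  jOneOne_of_i_of_ii p ends o a₁ a₂ a₃ b (zSplitI_of_rootsOnly_glued₂ p hp he hends hroot h1 o hb)
    (zSplitII_of_rootsOnly_glued₂ p hp he hends hroot h1 o b)

/-- **`(J1₁)` for the glued root-only class** (`w` glued to `a₁`). -/
theorem jOneOne_of_rootsOnly_glued₁ (p : E → R) (hp : IsProbVec p) (he : p e = 1)
    (hends : ends e = s(a₁, w))
    (hroot : ∀ e', a₃ ∈ ends e' → ends e' = s(w, a₃) ∨ ends e' = s(a₂, a₃)) (hw : w ≠ a₃)
    (o : V) {b : V} (hb : b ≠ a₃) : JOneOne p ends o a₁ a₂ a₃ b :=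
  jOneOne_of_i_of_ii p ends o a₁ a₂ a₃ b (zSplitI_of_rootsOnly_glued₁ p hp he hends hroot hw o hb)
    (zSplitII_of_rootsOnly_glued₁ p hp he hends hroot hw o b)

/-- **`(ii-Q)` for the glued root-only class** (`w` glued to `a₂`). -/
theorem zSplitIIQ_of_rootsOnly_glued₂ (p : E → R) (hp : IsProbVec p) (he : p e = 1)
    (hends : ends e = s(a₂, w))
    (hroot : ∀ e', a₃ ∈ ends e' → ends e' = s(a₁, a₃) ∨ ends e' = s(w, a₃)) (h1 : a₁ ≠ a₃)
    (o b : V) : ZSplitIIQ p ends o a₁ a₂ a₃ b :=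
  (zSplitIIQ_glue₂ he hends o a₁ a₃ b).2 (zSplitIIQ_of_rootsOnly p hp hroot h1 o b)

/-- **`(ii-Q)` for the glued root-only class** (`w` glued to `a₁`). -/
theorem zSplitIIQ_of_rootsOnly_glued₁ (p : E → R) (hp : IsProbVec p) (he : p e = 1)
    (hends : ends e = s(a₁, w))
    (hroot : ∀ e', a₃ ∈ ends e' → ends e' = s(w, a₃) ∨ ends e' = s(a₂, a₃)) (hw : w ≠ a₃)
    (o b : V) : ZSplitIIQ p ends o a₁ a₂ a₃ b :=
  (zSplitIIQ_glue₁ he hends o a₂ a₃ b).2 (zSplitIIQ_of_rootsOnly p hp hroot hw o b)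

/-- **`(i-Q)` for the glued root-only class** (`w` glued to `a₂`). -/
theorem zSplitIQ_of_rootsOnly_glued₂ (p : E → R) (hp : IsProbVec p) (he : p e = 1)
    (hends : ends e = s(a₂, w))
    (hroot : ∀ e', a₃ ∈ ends e' → ends e' = s(a₁, a₃) ∨ ends e' = s(w, a₃)) (h1 : a₁ ≠ a₃)
    (o : V) {b : V} (hb : b ≠ a₃) : ZSplitIQ p ends o a₁ a₂ a₃ b :=
  (zSplitIQ_glue₂ he hends o a₁ a₃ b).2 (zSplitIQ_of_rootsOnly p hp hroot h1 o hb)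

/-- **`(i-Q)` for the glued root-only class** (`w` glued to `a₁`). -/
theorem zSplitIQ_of_rootsOnly_glued₁ (p : E → R) (hp : IsProbVec p) (he : p e = 1)
    (hends : ends e = s(a₁, w))
    (hroot : ∀ e', a₃ ∈ ends e' → ends e' = s(w, a₃) ∨ ends e' = s(a₂, a₃)) (hw : w ≠ a₃)
    (o : V) {b : V} (hb : b ≠ a₃) : ZSplitIQ p ends o a₁ a₂ a₃ b :=
  (zSplitIQ_glue₁ he hends o a₂ a₃ b).2 (zSplitIQ_of_rootsOnly p hp hroot hw o hb)

/-- **`(ii)` for `a₃` adjacent to `a₁`, to `w` and to `o`, with `w` glued to the root `a₂`** (the face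
`e(w–a₂) = 3` of a gadget whose statement vertex sees a root, the glued vertex and `o`). -/
theorem zSplitII_of_rootsAndO_glued₂ (p : E → R) (hp : IsProbVec p) (he : p e = 1)
    (hends : ends e = s(a₂, w)) {e₀ : E} {o : V} (he₀ : ends e₀ = s(o, a₃))
    (hroot : ∀ e', a₃ ∈ ends e' → e' ≠ e₀ → ends e' = s(a₁, a₃) ∨ ends e' = s(w, a₃))
    (ho : o ≠ a₃) (h1 : a₁ ≠ a₃) (hw : w ≠ a₃) {b : V} (hb : b ≠ a₃) :
    ZSplitII p ends o a₁ a₂ a₃ b :=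
  (zSplitII_glue₂ he hends o a₁ a₃ b).2 (zSplitII_of_rootsAndO p hp he₀ hroot ho h1 hw hb)

/-- **`(ii)` for `a₃` adjacent to `w`, to `a₂` and to `o`, with `w` glued to the root `a₁`.** -/
theorem zSplitII_of_rootsAndO_glued₁ (p : E → R) (hp : IsProbVec p) (he : p e = 1)
    (hends : ends e = s(a₁, w)) {e₀ : E} {o : V} (he₀ : ends e₀ = s(o, a₃))
    (hroot : ∀ e', a₃ ∈ ends e' → e' ≠ e₀ → ends e' = s(w, a₃) ∨ ends e' = s(a₂, a₃))
    (ho : o ≠ a₃) (hw : w ≠ a₃) (h2 : a₂ ≠ a₃) {b : V} (hb : b ≠ a₃) :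
    ZSplitII p ends o a₁ a₂ a₃ b :=
  (zSplitII_glue₁ he hends o a₂ a₃ b).2 (zSplitII_of_rootsAndO p hp he₀ hroot ho hw h2 hb)

/-- **`(ii)` for `a₃` adjacent to `a₁`, to `w` and to `b`, with `w` glued to the root `a₂`.** -/
theorem zSplitII_of_rootsAndB_glued₂ (p : E → R) (hp : IsProbVec p) (he : p e = 1)
    (hends : ends e = s(a₂, w)) {e₀ : E} {b : V} (he₀ : ends e₀ = s(b, a₃))
    (hroot : ∀ e', a₃ ∈ ends e' → e' ≠ e₀ → ends e' = s(a₁, a₃) ∨ ends e' = s(w, a₃))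
    (hb : b ≠ a₃) (h1 : a₁ ≠ a₃) (hw : w ≠ a₃) {o : V} (ho : o ≠ a₃) :
    ZSplitII p ends o a₁ a₂ a₃ b :=
  (zSplitII_glue₂ he hends o a₁ a₃ b).2 (zSplitII_of_rootsAndB p hp he₀ hroot hb h1 hw ho)

/-- **`(ii)` for `a₃` adjacent to `w`, to `a₂` and to `b`, with `w` glued to the root `a₁`.** -/
theorem zSplitII_of_rootsAndB_glued₁ (p : E → R) (hp : IsProbVec p) (he : p e = 1)
    (hends : ends e = s(a₁, w)) {e₀ : E} {b : V} (he₀ : ends e₀ = s(b, a₃))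
    (hroot : ∀ e', a₃ ∈ ends e' → e' ≠ e₀ → ends e' = s(w, a₃) ∨ ends e' = s(a₂, a₃))
    (hb : b ≠ a₃) (hw : w ≠ a₃) (h2 : a₂ ≠ a₃) {o : V} (ho : o ≠ a₃) :
    ZSplitII p ends o a₁ a₂ a₃ b :=
  (zSplitII_glue₁ he hends o a₂ a₃ b).2 (zSplitII_of_rootsAndB p hp he₀ hroot hb hw h2 ho)

end Glued

/-! ## The Bernstein face lemma -/

section Bernstein
variable {R : Type*} [CommRing R] [LinearOrder R] [IsStrictOrderedRing R]

/-- **The Bernstein face lemma (top face).** A cubic `f` in an edge weight `t` with Bernstein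
coefficients `B₀, B₁, B₂, B₃` is nonnegative on `[0, 1]` as soon as `B₀, B₁, B₂ ≥ 0` and the face
value `f 1` (`= B₃`) is nonnegative — the face being the instance with the edge glued. -/
theorem nonneg_of_bern3_top_face (f : R → R) (B₀ B₁ B₂ B₃ : R)
    (hf : ∀ t, f t = (1 - t) ^ 3 * B₀ + 3 * (t * (1 - t) ^ 2) * B₁ + 3 * (t ^ 2 * (1 - t)) * B₂ +
      t ^ 3 * B₃)
    (h0 : 0 ≤ B₀) (h1 : 0 ≤ B₁) (h2 : 0 ≤ B₂) (h3 : 0 ≤ f 1) {t : R} (ht0 : 0 ≤ t) (ht1 : t ≤ 1) :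
    0 ≤ f t := by
  have hB3 : B₃ = f 1 := by rw [hf 1]; ring
  have hB3' : 0 ≤ B₃ := hB3 ▸ h3
  rw [hf t]
  have h1t : 0 ≤ 1 - t := sub_nonneg.2 ht1
  have h3' : (0 : R) ≤ 3 := by norm_num
  refine add_nonneg (add_nonneg (add_nonneg (mul_nonneg (pow_nonneg h1t 3) h0)
    (mul_nonneg (mul_nonneg h3' (mul_nonneg ht0 (pow_nonneg h1t 2))) h1))
    (mul_nonneg (mul_nonneg h3' (mul_nonneg (pow_nonneg ht0 2) h1t)) h2))
    (mul_nonneg (pow_nonneg ht0 3) hB3')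

/-- **The Bernstein face lemma (both faces).** Interior coefficients `B₁, B₂ ≥ 0` and face values
`f 0` (`= B₀`, the edge deleted) and `f 1` (`= B₃`, the edge glued) nonnegative give `f ≥ 0` on
`[0, 1]`. -/
theorem nonneg_of_bern3_faces (f : R → R) (B₀ B₁ B₂ B₃ : R)
    (hf : ∀ t, f t = (1 - t) ^ 3 * B₀ + 3 * (t * (1 - t) ^ 2) * B₁ + 3 * (t ^ 2 * (1 - t)) * B₂ +
      t ^ 3 * B₃)
    (h0 : 0 ≤ f 0) (h1 : 0 ≤ B₁) (h2 : 0 ≤ B₂) (h3 : 0 ≤ f 1) {t : R} (ht0 : 0 ≤ t) (ht1 : t ≤ 1) :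
    0 ≤ f t := by
  have hB0 : B₀ = f 0 := by rw [hf 0]; ring
  exact nonneg_of_bern3_top_face f B₀ B₁ B₂ B₃ hf (hB0 ▸ h0) h1 h2 h3 ht0 ht1

end Bernstein

end CaseOne

end Summit.Ventures.PercRepro2
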